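import Summits.CriticalPhenomena.Ising3DConformalLimit.Theses.SynchronousCoupling
import Literature.Probability.LatticeModels.PlusMinusStateGibbs
import Literature.Probability.LatticeModels.MessagerMiracleSole
import Literature.Probability.LatticeModels.SharpnessLROProofs
import Literature.Probability.LatticeModels.HighDimTrivialityMoments
import HarnessLib

/-!
# Route `CoerciveSharpness`, crux `DimensionPinned` (item stmt-CriticalPhenomena-4662), line `Sketch`
# (octave telescoping on block variances): registered stub `stub_dock`

**The dock.** The crux `SynchronousCoupling.DilationJoinings` (item stmt-CriticalPhenomena-18762)
implies the rate hypothesis DCR₂₇ of the line: a power rate, under `L → 2L`, for the 27 nearest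
normalised block covariances `R_L(u) = C_L(u) / V_L` (`|u_i| ≤ 1`) of the critical two-point
function `G = criticalTwoPoint 3`, where `C_L(u) = Σ_{x ∈ Q_L} Σ_{y ∈ Q_L(u)} G(y - x)`,
`Q_L = [0,L)³`, `Q_L(u) = L u + [0,L)³`, `V_L = C_L(0)`.

Mechanism.  Take the plus Gibbs measure `μ` at `β_c(3)` (`exists_plusMeasure_holds`: DLR,
translation invariant, correlations `plusCorr`), whose pair integrals are
`∫ σ_x σ_y dμ = G(y - x)` (`plusCorr_pair_shift`, `twoPointPlus_eq_plusCorr_pair`), so that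
`∫ X_0 X_u dμ = C_{2L}(u)`, `∫ Y_0 Y_u dμ = C_L(u)` for the block sums `X_u` (side `2L`, corner
`2L u`) and `Y_u` (side `L`, corner `L u`), and `∫ Y_u² dμ = V_L` (re-indexing the translated
cube).  The crux at `p = 2`, window `m = 1`, scale `b = L` gives a joining `π` of `μ` with `μ` under
which `F_u = a X_u(q.1) - b Y_u(q.2)` (`a = (√V_{2L})⁻¹`, `b = (√V_L)⁻¹`) has
`∫ F_u² dπ ≤ C L^{-θ}` for `u` and for `0`.  The identity
`a² X_0 X_u - b² Y_0 Y_u = F_u · (a X_0) + (b Y_u) · F_0`, the marginal identities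
(`MeasureTheory.integral_map`) and Cauchy–Schwarz in `L²(π)` (`‖a X_0‖₂ = ‖b Y_u‖₂ = 1`) give
`|R_{2L}(u) - R_L(u)| ≤ ‖F_u‖₂ + ‖F_0‖₂ ≤ 2 √C L^{-θ/2}`.

Helper file (`--supports`); the composition lives in the lead's skeleton
`Cruxes/DimensionPinned/Lines/Sketch.lean`.  No definition, no notation, no named fact.
-/

noncomputable section

namespace Summit.CriticalPhenomena.Ising3DConformalLimit.Theorems.CoerciveSharpnessDimensionPinned

open MeasureTheory Finset
open Literature.Probability.LatticeModels
open Summit.CriticalPhenomena.Ising3DConformalLimit.Theses.SynchronousCoupling (DilationJoinings)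

/-! ## Pair integrals of the critical plus state -/

/-- **Pair integrals of the plus state at `β_c(3)` are the critical two-point function**:
for a probability measure `μ` with `⟨σ_A⟩_μ = plusCorr 3 β_c 0 A`,
`∫ σ_x σ_y dμ = ⟨σ_0 σ_{y-x}⟩⁺_{β_c} = criticalTwoPoint 3 (y - x)` (translation invariance of the
plus state, Friedli–Velenik 2017, Thm. 3.17; `σ_x² = 1` on the diagonal).
[cite: FriedliVelenik2017, Thm. 3.17 and Thm. 6.26] -/
theorem dock_integral_spinAt_mul_spinAt {μ : Measure (SpinConfig (Site 3))} [IsProbabilityMeasure μ]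
    (hμ : ∀ A : Finset (Site 3), spinCorr μ A = plusCorr 3 (criticalBeta 3) 0 A) (x y : Site 3) :
    ∫ σ, spinAt x σ * spinAt y σ ∂μ = criticalTwoPoint 3 (y - x) := by
  by_cases hxy : x = y
  · subst hxy
    have h0 : criticalTwoPoint 3 (0 : Site 3) = 1 := twoPointPlus_origin _
    simp [h0]
  · have hpair : (∫ σ, spinAt x σ * spinAt y σ ∂μ) = spinCorr μ {x, y} := by
      simp only [spinCorr, spinProduct, Finset.prod_pair hxy]
    have hv : y - x ≠ 0 := sub_ne_zero.2 (Ne.symm hxy)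
    have hshift := plusCorr_pair_shift (d := 3) (criticalBeta_nonneg 3) x (y - x)
    rw [show x + (y - x) = y by abel] at hshift
    rw [hpair, hμ, hshift]
    exact (twoPointPlus_eq_plusCorr_pair (criticalBeta 3) hv).symm

/-- **Mixed second moments of block sums**: `∫ (Σ_{x∈A} σ_x)(Σ_{y∈B} σ_y) dμ = Σ_{x∈A} Σ_{y∈B} G(y-x)`
for the plus state at `β_c(3)` (linearity of the integral; bounded integrands). [folklore] -/
theorem dock_integral_blockSum_mul {μ : Measure (SpinConfig (Site 3))} [IsProbabilityMeasure μ]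
    (hμ : ∀ A : Finset (Site 3), spinCorr μ A = plusCorr 3 (criticalBeta 3) 0 A)
    (A B : Finset (Site 3)) :
    ∫ σ, (∑ x ∈ A, spinAt x σ) * (∑ y ∈ B, spinAt y σ) ∂μ =
      ∑ x ∈ A, ∑ y ∈ B, criticalTwoPoint 3 (y - x) := by
  simp_rw [Finset.sum_mul_sum]
  rw [integral_finsetSum _ fun x _ =>
    integrable_finsetSum _ fun y _ => integrable_spinAt_mul_spinAt μ x y]
  refine Finset.sum_congr rfl fun x _ => ?_
  rw [integral_finsetSum _ fun y _ => integrable_spinAt_mul_spinAt μ x y]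
  exact Finset.sum_congr rfl fun y _ => dock_integral_spinAt_mul_spinAt hμ x y

/-! ## Cubes: re-indexing a translated cube, positivity of the block variance -/

/-- Re-indexing a sum over the translated cube `L u + [0,L)³` as a sum over `[0,L)³`. [folklore] -/
theorem dock_sum_shiftedCube (L : ℤ) (u : Fin 3 → ℤ) (f : Site 3 → ℝ) :
    ∑ x ∈ Fintype.piFinset (fun i : Fin 3 => Finset.Ico (L * u i) (L * u i + L)), f x =
      ∑ x ∈ Fintype.piFinset (fun _ : Fin 3 => Finset.Ico (0:ℤ) L), f (x + L • u) := by
  refine Finset.sum_nbij' (fun x => x - L • u) (fun x => x + L • u) ?_ ?_ ?_ ?_ ?_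
  · intro x hx
    simp only [Fintype.mem_piFinset, Finset.mem_Ico] at hx ⊢
    intro i
    have h := hx i
    simp only [Pi.sub_apply, Pi.smul_apply, smul_eq_mul]
    constructor <;> linarith [h.1, h.2]
  · intro x hx
    simp only [Fintype.mem_piFinset, Finset.mem_Ico] at hx ⊢
    intro i
    have h := hx i
    simp only [Pi.add_apply, Pi.smul_apply, smul_eq_mul]
    constructor <;> linarith [h.1, h.2]
  · intro x _; simp
  · intro x _; simp
  · intro x _; simp

/-- **Translation invariance of the block variance written with `G`**:
`Σ_{x,y ∈ L u + [0,L)³} G(y-x) = Σ_{x,y ∈ [0,L)³} G(y-x)`. [folklore] -/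
theorem dock_sum_sum_shiftedCube (L : ℤ) (u : Fin 3 → ℤ) (G : Site 3 → ℝ) :
    ∑ x ∈ Fintype.piFinset (fun i : Fin 3 => Finset.Ico (L * u i) (L * u i + L)),
        ∑ y ∈ Fintype.piFinset (fun i : Fin 3 => Finset.Ico (L * u i) (L * u i + L)), G (y - x) =
      ∑ x ∈ Fintype.piFinset (fun _ : Fin 3 => Finset.Ico (0:ℤ) L),
        ∑ y ∈ Fintype.piFinset (fun _ : Fin 3 => Finset.Ico (0:ℤ) L), G (y - x) := by
  rw [dock_sum_shiftedCube]
  refine Finset.sum_congr rfl fun x _ => ?_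
  rw [dock_sum_shiftedCube]
  refine Finset.sum_congr rfl fun y _ => ?_
  rw [add_sub_add_right_eq_sub]

/-- **The block variance is positive**: `0 < Σ_{x,y ∈ [0,L)³} G(y-x)` for `L ≥ 1` (all terms are
`≥ 0` by GKS, `twoPointPlus_nonneg_of_gks`, and the diagonal term at the origin is `G 0 = 1`).
[folklore] -/
theorem dock_cubeSum_pos {L : ℤ} (hL : 0 < L) :
    0 < ∑ x ∈ Fintype.piFinset (fun _ : Fin 3 => Finset.Ico (0:ℤ) L),
          ∑ y ∈ Fintype.piFinset (fun _ : Fin 3 => Finset.Ico (0:ℤ) L), criticalTwoPoint 3 (y - x) := by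
  have h0 : (0 : Site 3) ∈ Fintype.piFinset (fun _ : Fin 3 => Finset.Ico (0:ℤ) L) := by
    simp [hL]
  have hG0 : ∀ v : Site 3, 0 ≤ criticalTwoPoint 3 v := fun v =>
    twoPointPlus_nonneg_of_gks (criticalBeta_nonneg 3) v
  calc (0:ℝ) < 1 := one_pos
    _ = criticalTwoPoint 3 ((0 : Site 3) - 0) := by
        rw [sub_zero]; exact (twoPointPlus_origin _).symm
    _ ≤ ∑ y ∈ Fintype.piFinset (fun _ : Fin 3 => Finset.Ico (0:ℤ) L), criticalTwoPoint 3 (y - 0) :=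
        Finset.single_le_sum (f := fun y => criticalTwoPoint 3 (y - 0)) (fun y _ => hG0 _) h0
    _ ≤ _ := Finset.single_le_sum
        (f := fun x => ∑ y ∈ Fintype.piFinset (fun _ : Fin 3 => Finset.Ico (0:ℤ) L),
          criticalTwoPoint 3 (y - x)) (fun x _ => Finset.sum_nonneg fun y _ => hG0 _) h0

/-! ## `L²` tools on the pair space -/

/-- The product of two bounded measurable real functions is integrable against a finite measure.
[folklore] -/
theorem dock_integrable_mul {Ω : Type*} [MeasurableSpace Ω] {P : Measure Ω} [IsFiniteMeasure P]
    {f g : Ω → ℝ} (hf : Measurable f ∧ ∃ K, ∀ ω, |f ω| ≤ K) (hg : Measurable g ∧ ∃ K, ∀ ω, |g ω| ≤ K) :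
    Integrable (fun ω => f ω * g ω) P := by
  obtain ⟨hfm, Kf, hKf⟩ := hf
  obtain ⟨hgm, Kg, hKg⟩ := hg
  exact Integrable.of_bound (hfm.mul hgm).aestronglyMeasurable (Kf * Kg)
    (ae_of_all _ fun ω => by
      rw [Real.norm_eq_abs, abs_mul]
      exact mul_le_mul (hKf ω) (hKg ω) (abs_nonneg _) ((abs_nonneg _).trans (hKf ω)))

/-- The square of a bounded measurable real function is integrable against a finite measure.
[folklore] -/
theorem dock_integrable_sq {Ω : Type*} [MeasurableSpace Ω] {P : Measure Ω} [IsFiniteMeasure P]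
    {f : Ω → ℝ} (hf : Measurable f ∧ ∃ K, ∀ ω, |f ω| ≤ K) :
    Integrable (fun ω => f ω ^ 2) P := by
  simpa only [sq] using dock_integrable_mul hf hf

/-- Bounded measurable functions are stable under `(f, g) ↦ a f - b g`. [folklore] -/
theorem dock_bm_affine {Ω : Type*} [MeasurableSpace Ω] {f g : Ω → ℝ}
    (hf : Measurable f ∧ ∃ K, ∀ ω, |f ω| ≤ K) (hg : Measurable g ∧ ∃ K, ∀ ω, |g ω| ≤ K) (a b : ℝ) :
    Measurable (fun ω => a * f ω - b * g ω) ∧ ∃ K, ∀ ω, |a * f ω - b * g ω| ≤ K := by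
  obtain ⟨hfm, Kf, hKf⟩ := hf
  obtain ⟨hgm, Kg, hKg⟩ := hg
  refine ⟨(hfm.const_mul a).sub (hgm.const_mul b), |a| * Kf + |b| * Kg, fun ω => ?_⟩
  calc |a * f ω - b * g ω| ≤ |a * f ω| + |b * g ω| := abs_sub _ _
    _ = |a| * |f ω| + |b| * |g ω| := by rw [abs_mul, abs_mul]
    _ ≤ |a| * Kf + |b| * Kg :=
        add_le_add (mul_le_mul_of_nonneg_left (hKf ω) (abs_nonneg a))
          (mul_le_mul_of_nonneg_left (hKg ω) (abs_nonneg b))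

/-- Bounded measurable functions are stable under `f ↦ a f`. [folklore] -/
theorem dock_bm_const_mul {Ω : Type*} [MeasurableSpace Ω] {f : Ω → ℝ}
    (hf : Measurable f ∧ ∃ K, ∀ ω, |f ω| ≤ K) (a : ℝ) :
    Measurable (fun ω => a * f ω) ∧ ∃ K, ∀ ω, |a * f ω| ≤ K := by
  obtain ⟨hfm, K, hK⟩ := hf
  refine ⟨hfm.const_mul a, |a| * K, fun ω => ?_⟩
  rw [abs_mul]
  exact mul_le_mul_of_nonneg_left (hK ω) (abs_nonneg a)

/-- **Cauchy–Schwarz** for real integrals, `|∫ f g| ≤ √(∫ f²) √(∫ g²)`, from the sign of the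
discriminant of `t ↦ ∫ (t f - g)²`. [folklore] -/
theorem dock_cauchySchwarz {Ω : Type*} [MeasurableSpace Ω] (P : Measure Ω)
    (f g : Ω → ℝ) (hf : Integrable (fun ω => f ω ^ 2) P) (hg : Integrable (fun ω => g ω ^ 2) P)
    (hfg : Integrable (fun ω => f ω * g ω) P) :
    |∫ ω, f ω * g ω ∂P| ≤ Real.sqrt (∫ ω, f ω ^ 2 ∂P) * Real.sqrt (∫ ω, g ω ^ 2 ∂P) := by
  have hA0 : 0 ≤ ∫ ω, f ω ^ 2 ∂P := integral_nonneg fun ω => sq_nonneg _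
  have hquad : ∀ t : ℝ, 0 ≤ (∫ ω, f ω ^ 2 ∂P) * (t * t) + (-(2 * ∫ ω, f ω * g ω ∂P)) * t
      + ∫ ω, g ω ^ 2 ∂P := by
    intro t
    have h1 : Integrable (fun ω => t * t * f ω ^ 2 - 2 * t * (f ω * g ω)) P :=
      (hf.const_mul _).sub (hfg.const_mul _)
    have h2 : (fun ω => (t * f ω - g ω) ^ 2)
        = fun ω => t * t * f ω ^ 2 - 2 * t * (f ω * g ω) + g ω ^ 2 := by
      funext ω; ring
    have h3 : 0 ≤ ∫ ω, (t * f ω - g ω) ^ 2 ∂P := integral_nonneg fun ω => sq_nonneg _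
    rw [h2, integral_add h1 hg, integral_sub (hf.const_mul _) (hfg.const_mul _),
      integral_const_mul, integral_const_mul] at h3
    linarith
  have hdisc := discrim_le_zero hquad
  rw [discrim] at hdisc
  rw [← Real.sqrt_mul hA0]
  refine Real.abs_le_sqrt ?_
  nlinarith [hdisc]

/-- **Marginal identity, first factor**: `∫ f(q.1) dπ = ∫ f dμ` when `π.fst = μ`
(`MeasureTheory.integral_map`, no integrability needed). [folklore] -/
theorem dock_integral_fst {Ω : Type*} [MeasurableSpace Ω] {μ : Measure Ω} {π : Measure (Ω × Ω)}
    (hfst : π.fst = μ) {f : Ω → ℝ} (hf : Measurable f) : ∫ q, f q.1 ∂π = ∫ ω, f ω ∂μ := by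
  rw [← hfst, Measure.fst, integral_map measurable_fst.aemeasurable hf.aestronglyMeasurable]

/-- **Marginal identity, second factor**: `∫ f(q.2) dπ = ∫ f dμ` when `π.snd = μ`. [folklore] -/
theorem dock_integral_snd {Ω : Type*} [MeasurableSpace Ω] {μ : Measure Ω} {π : Measure (Ω × Ω)}
    (hsnd : π.snd = μ) {f : Ω → ℝ} (hf : Measurable f) : ∫ q, f q.2 ∂π = ∫ ω, f ω ∂μ := by
  rw [← hsnd, Measure.snd, integral_map measurable_snd.aemeasurable hf.aestronglyMeasurable]

/-- **The Cauchy–Schwarz core of the dock** (abstract form).  On a probability space `(Ω, μ)` let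
`X₀, X₁, Y₀, Y₁` be bounded measurable, `cX = ∫ X₀X₁`, `vX = ∫ X₀² > 0`, `cY = ∫ Y₀Y₁`,
`vY = ∫ Y₀² = ∫ Y₁² > 0`, and let `π` be a joining of `μ` with `μ` under which the self-normalised
differences `(√vX)⁻¹ X_i(q.1) - (√vY)⁻¹ Y_i(q.2)`, `i = 0, 1`, have second moment `≤ ε`.  Then
`|cX / vX - cY / vY| ≤ 2 √ε`:  with `a = (√vX)⁻¹`, `b = (√vY)⁻¹`, `F_i = a X_i(q.1) - b Y_i(q.2)`,
`a² X₀X₁ - b² Y₀Y₁ = F₁ (a X₀) + (b Y₁) F₀`, and `‖a X₀‖₂ = ‖b Y₁‖₂ = 1` in `L²(π)`. [folklore] -/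
theorem dock_core {Ω : Type*} [MeasurableSpace Ω] {μ : Measure Ω} [IsProbabilityMeasure μ]
    {π : Measure (Ω × Ω)} (hfst : π.fst = μ) (hsnd : π.snd = μ)
    {X₀ X₁ Y₀ Y₁ : Ω → ℝ} (hX₀ : Measurable X₀) (hX₁ : Measurable X₁) (hY₀ : Measurable Y₀)
    (hY₁ : Measurable Y₁) (bX₀ : ∃ K, ∀ ω, |X₀ ω| ≤ K) (bX₁ : ∃ K, ∀ ω, |X₁ ω| ≤ K)
    (bY₀ : ∃ K, ∀ ω, |Y₀ ω| ≤ K) (bY₁ : ∃ K, ∀ ω, |Y₁ ω| ≤ K)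
    {cX vX cY vY ε : ℝ} (hcX : ∫ ω, X₀ ω * X₁ ω ∂μ = cX) (hvX : ∫ ω, X₀ ω * X₀ ω ∂μ = vX)
    (hcY : ∫ ω, Y₀ ω * Y₁ ω ∂μ = cY) (hvY : ∫ ω, Y₀ ω * Y₀ ω ∂μ = vY)
    (hvY₁ : ∫ ω, Y₁ ω * Y₁ ω ∂μ = vY) (hvX0 : 0 < vX) (hvY0 : 0 < vY)
    (h₁ : ∫ q, ((Real.sqrt (∫ ω, X₀ ω ^ 2 ∂μ))⁻¹ * X₁ q.1 -
        (Real.sqrt (∫ ω, Y₀ ω ^ 2 ∂μ))⁻¹ * Y₁ q.2) ^ 2 ∂π ≤ ε)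
    (h₀ : ∫ q, ((Real.sqrt (∫ ω, X₀ ω ^ 2 ∂μ))⁻¹ * X₀ q.1 -
        (Real.sqrt (∫ ω, Y₀ ω ^ 2 ∂μ))⁻¹ * Y₀ q.2) ^ 2 ∂π ≤ ε) :
    |cX / vX - cY / vY| ≤ 2 * Real.sqrt ε := by
  -- the normalisers
  have hvX' : ∫ ω, X₀ ω ^ 2 ∂μ = vX := by simp_rw [sq]; exact hvX
  have hvY' : ∫ ω, Y₀ ω ^ 2 ∂μ = vY := by simp_rw [sq]; exact hvY
  rw [hvX', hvY'] at h₁ h₀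
  set a : ℝ := (Real.sqrt vX)⁻¹ with ha
  set b : ℝ := (Real.sqrt vY)⁻¹ with hb
  have ha2 : a ^ 2 = vX⁻¹ := by rw [ha, inv_pow, Real.sq_sqrt hvX0.le]
  have hb2 : b ^ 2 = vY⁻¹ := by rw [hb, inv_pow, Real.sq_sqrt hvY0.le]
  have ha2v : a ^ 2 * vX = 1 := by rw [ha2, inv_mul_cancel₀ hvX0.ne']
  have hb2v : b ^ 2 * vY = 1 := by rw [hb2, inv_mul_cancel₀ hvY0.ne']
  -- `π` is a probability measure
  haveI : IsProbabilityMeasure π :=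
    ⟨by rw [← Measure.fst_univ, hfst]; exact measure_univ⟩
  -- bounded measurable functions on the pair space
  have mX₀ : Measurable (fun q : Ω × Ω => X₀ q.1) ∧ ∃ K, ∀ q : Ω × Ω, |X₀ q.1| ≤ K :=
    ⟨hX₀.comp measurable_fst, bX₀.imp fun K hK q => hK q.1⟩
  have mX₁ : Measurable (fun q : Ω × Ω => X₁ q.1) ∧ ∃ K, ∀ q : Ω × Ω, |X₁ q.1| ≤ K :=
    ⟨hX₁.comp measurable_fst, bX₁.imp fun K hK q => hK q.1⟩
  have mY₀ : Measurable (fun q : Ω × Ω => Y₀ q.2) ∧ ∃ K, ∀ q : Ω × Ω, |Y₀ q.2| ≤ K :=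
    ⟨hY₀.comp measurable_snd, bY₀.imp fun K hK q => hK q.2⟩
  have mY₁ : Measurable (fun q : Ω × Ω => Y₁ q.2) ∧ ∃ K, ∀ q : Ω × Ω, |Y₁ q.2| ≤ K :=
    ⟨hY₁.comp measurable_snd, bY₁.imp fun K hK q => hK q.2⟩
  have mF₁ := dock_bm_affine mX₁ mY₁ a b
  have mF₀ := dock_bm_affine mX₀ mY₀ a b
  have mG := dock_bm_const_mul mX₀ a
  have mH := dock_bm_const_mul mY₁ b
  -- integrability of the products that occur
  have iF₁G : Integrable (fun q : Ω × Ω => (a * X₁ q.1 - b * Y₁ q.2) * (a * X₀ q.1)) π :=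
    dock_integrable_mul mF₁ mG
  have iHF₀ : Integrable (fun q : Ω × Ω => (b * Y₁ q.2) * (a * X₀ q.1 - b * Y₀ q.2)) π :=
    dock_integrable_mul mH mF₀
  have iF₁2 : Integrable (fun q : Ω × Ω => (a * X₁ q.1 - b * Y₁ q.2) ^ 2) π :=
    dock_integrable_sq mF₁
  have iF₀2 : Integrable (fun q : Ω × Ω => (a * X₀ q.1 - b * Y₀ q.2) ^ 2) π :=
    dock_integrable_sq mF₀
  have iG2 : Integrable (fun q : Ω × Ω => (a * X₀ q.1) ^ 2) π := dock_integrable_sq mG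
  have iH2 : Integrable (fun q : Ω × Ω => (b * Y₁ q.2) ^ 2) π := dock_integrable_sq mH
  have iX01 : Integrable (fun q : Ω × Ω => X₀ q.1 * X₁ q.1) π := dock_integrable_mul mX₀ mX₁
  have iY01 : Integrable (fun q : Ω × Ω => Y₀ q.2 * Y₁ q.2) π := dock_integrable_mul mY₀ mY₁
  -- marginal identities
  have eX01 : ∫ q, X₀ q.1 * X₁ q.1 ∂π = cX := by
    rw [← hcX]; exact dock_integral_fst hfst (f := fun ω => X₀ ω * X₁ ω) (hX₀.mul hX₁)
  have eY01 : ∫ q, Y₀ q.2 * Y₁ q.2 ∂π = cY := by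
    rw [← hcY]; exact dock_integral_snd hsnd (f := fun ω => Y₀ ω * Y₁ ω) (hY₀.mul hY₁)
  have eG2 : ∫ q, (a * X₀ q.1) ^ 2 ∂π = 1 := by
    have e : (fun q : Ω × Ω => (a * X₀ q.1) ^ 2) = fun q => a ^ 2 * (X₀ q.1 * X₀ q.1) := by
      funext q; ring
    rw [e, integral_const_mul, dock_integral_fst hfst (f := fun ω => X₀ ω * X₀ ω) (hX₀.mul hX₀),
      hvX, ha2v]
  have eH2 : ∫ q, (b * Y₁ q.2) ^ 2 ∂π = 1 := by
    have e : (fun q : Ω × Ω => (b * Y₁ q.2) ^ 2) = fun q => b ^ 2 * (Y₁ q.2 * Y₁ q.2) := by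
      funext q; ring
    rw [e, integral_const_mul, dock_integral_snd hsnd (f := fun ω => Y₁ ω * Y₁ ω) (hY₁.mul hY₁),
      hvY₁, hb2v]
  -- the algebraic identity `a² X₀X₁ - b² Y₀Y₁ = F₁ (a X₀) + (b Y₁) F₀`, integrated
  have hsplit : a ^ 2 * cX - b ^ 2 * cY =
      (∫ q, (a * X₁ q.1 - b * Y₁ q.2) * (a * X₀ q.1) ∂π) +
        ∫ q, (b * Y₁ q.2) * (a * X₀ q.1 - b * Y₀ q.2) ∂π := by
    rw [← integral_add iF₁G iHF₀]
    have e : (fun q : Ω × Ω => (a * X₁ q.1 - b * Y₁ q.2) * (a * X₀ q.1) +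
        (b * Y₁ q.2) * (a * X₀ q.1 - b * Y₀ q.2)) =
        fun q => a ^ 2 * (X₀ q.1 * X₁ q.1) - b ^ 2 * (Y₀ q.2 * Y₁ q.2) := by
      funext q; ring
    rw [e, integral_sub (iX01.const_mul _) (iY01.const_mul _), integral_const_mul,
      integral_const_mul, eX01, eY01]
  have hR : cX / vX - cY / vY = a ^ 2 * cX - b ^ 2 * cY := by
    rw [ha2, hb2, div_eq_inv_mul, div_eq_inv_mul]
  -- Cauchy–Schwarz twice
  have hCS1 := dock_cauchySchwarz π (fun q => a * X₁ q.1 - b * Y₁ q.2) (fun q => a * X₀ q.1)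
    iF₁2 iG2 iF₁G
  have hCS2 := dock_cauchySchwarz π (fun q => b * Y₁ q.2) (fun q => a * X₀ q.1 - b * Y₀ q.2)
    iH2 iF₀2 iHF₀
  rw [eG2, Real.sqrt_one, mul_one] at hCS1
  rw [eH2, Real.sqrt_one, one_mul] at hCS2
  have hs1 : Real.sqrt (∫ q, (a * X₁ q.1 - b * Y₁ q.2) ^ 2 ∂π) ≤ Real.sqrt ε := Real.sqrt_le_sqrt h₁
  have hs0 : Real.sqrt (∫ q, (a * X₀ q.1 - b * Y₀ q.2) ^ 2 ∂π) ≤ Real.sqrt ε := Real.sqrt_le_sqrt h₀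
  rw [hR, hsplit]
  calc _ ≤ |∫ q, (a * X₁ q.1 - b * Y₁ q.2) * (a * X₀ q.1) ∂π| +
        |∫ q, (b * Y₁ q.2) * (a * X₀ q.1 - b * Y₀ q.2) ∂π| := abs_add_le _ _
    _ ≤ Real.sqrt ε + Real.sqrt ε := add_le_add (hCS1.trans hs1) (hCS2.trans hs0)
    _ = 2 * Real.sqrt ε := by ring

/-! ## The dock -/

/-- **stub `stub_dock` — `DilationJoinings` (item stmt-CriticalPhenomena-18762) implies DCR₂₇.**
Take the plus measure at `β_c(3)` (`exists_plusMeasure_holds`: DLR, translation invariant, pair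
integrals `criticalTwoPoint 3`), the joining `π` of the crux at `p = 2`, window `m = 1`, scale
`b = L`, and Cauchy–Schwarz in `L²(π)` (`dock_core`):
`|R_{2L}(u) - R_L(u)| ≤ ‖F_u‖₂ + ‖F_0‖₂ ≤ 2 √C L^{-θ/2}`. [folklore] -/
theorem stub_dock :
    DilationJoinings →
    ∃ θ C : ℝ, 0 < θ ∧ ∀ L : ℕ, 1 ≤ L → ∀ u : Fin 3 → ℤ, (∀ i, |u i| ≤ 1) →
      |(∑ x ∈ Fintype.piFinset (fun _ : Fin 3 => Finset.Ico (0:ℤ) (2 * (L:ℤ))),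
          ∑ y ∈ Fintype.piFinset (fun i : Fin 3 => Finset.Ico (2 * (L:ℤ) * u i) (2 * (L:ℤ) * u i + 2 * (L:ℤ))),
            criticalTwoPoint 3 (y - x)) /
        (∑ x ∈ Fintype.piFinset (fun _ : Fin 3 => Finset.Ico (0:ℤ) (2 * (L:ℤ))),
          ∑ y ∈ Fintype.piFinset (fun _ : Fin 3 => Finset.Ico (0:ℤ) (2 * (L:ℤ))), criticalTwoPoint 3 (y - x)) -
       (∑ x ∈ Fintype.piFinset (fun _ : Fin 3 => Finset.Ico (0:ℤ) (L:ℤ)),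
          ∑ y ∈ Fintype.piFinset (fun i : Fin 3 => Finset.Ico ((L:ℤ) * u i) ((L:ℤ) * u i + (L:ℤ))),
            criticalTwoPoint 3 (y - x)) /
        (∑ x ∈ Fintype.piFinset (fun _ : Fin 3 => Finset.Ico (0:ℤ) (L:ℤ)),
          ∑ y ∈ Fintype.piFinset (fun _ : Fin 3 => Finset.Ico (0:ℤ) (L:ℤ)), criticalTwoPoint 3 (y - x))|
      ≤ C * (L : ℝ) ^ (-θ) := by
  intro hDJ
  obtain ⟨μ, hμG, hTI, hμc⟩ :=
    exists_plusMeasure_holds (d := 3) (β := criticalBeta 3) (h := (0:ℝ)) (criticalBeta_nonneg 3)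
  haveI : IsProbabilityMeasure μ :=
    ((mem_isingGibbsMeasures_iff 3 _ 0 μ).1 hμG).isProbabilityMeasure
  obtain ⟨C, θ, hθ, hwin⟩ := hDJ μ hμG hTI 2 (Or.inl rfl)
  refine ⟨θ / 2, 2 * Real.sqrt C, half_pos hθ, fun L hL u hu => ?_⟩
  obtain ⟨π, hfst, hsnd, hdef⟩ := hwin L 1 hL
  have h1 := hdef u (fun i => by exact_mod_cast hu i)
  have h0 := hdef 0 (fun i => by simp)
  simp only [Nat.cast_ofNat] at h1
  simp only [Nat.cast_ofNat, Pi.zero_apply, mul_zero, zero_add] at h0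
  -- block sums: measurable and bounded
  have hbd : ∀ S : Finset (Site 3), ∃ K : ℝ, ∀ σ : SpinConfig (Site 3), |∑ x ∈ S, spinAt x σ| ≤ K := by
    intro S
    refine ⟨S.card, fun σ => ?_⟩
    calc |∑ x ∈ S, spinAt x σ| ≤ ∑ x ∈ S, |spinAt x σ| := Finset.abs_sum_le_sum_abs _ _
      _ = (S.card : ℝ) := by simp [abs_spinAt]
  have hmeasS : ∀ S : Finset (Site 3), Measurable fun σ : SpinConfig (Site 3) => ∑ x ∈ S, spinAt x σ :=
    fun S => Finset.measurable_sum S fun x _ => measurable_spinAt x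
  -- positivity of the block variances
  have hL0 : (0:ℤ) < (L:ℤ) := by have := hL; omega
  have h2L0 : (0:ℤ) < 2 * (L:ℤ) := by omega
  have hV1 := dock_cubeSum_pos hL0
  have hV2 := dock_cubeSum_pos h2L0
  -- the translated variance `∫ Y_u² dμ = V_L`
  have hY₁ : ∫ σ, (∑ x ∈ Fintype.piFinset (fun i : Fin 3 => Finset.Ico ((L:ℤ) * u i) ((L:ℤ) * u i + (L:ℤ))),
        spinAt x σ) *
      (∑ x ∈ Fintype.piFinset (fun i : Fin 3 => Finset.Ico ((L:ℤ) * u i) ((L:ℤ) * u i + (L:ℤ))),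
        spinAt x σ) ∂μ =
      ∑ x ∈ Fintype.piFinset (fun _ : Fin 3 => Finset.Ico (0:ℤ) (L:ℤ)),
        ∑ y ∈ Fintype.piFinset (fun _ : Fin 3 => Finset.Ico (0:ℤ) (L:ℤ)), criticalTwoPoint 3 (y - x) := by
    rw [dock_integral_blockSum_mul hμc]
    exact dock_sum_sum_shiftedCube (L:ℤ) u (criticalTwoPoint 3)
  have key := dock_core hfst hsnd
    (X₀ := fun σ => ∑ x ∈ Fintype.piFinset (fun _ : Fin 3 => Finset.Ico (0:ℤ) (2 * (L:ℤ))), spinAt x σ)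
    (X₁ := fun σ => ∑ x ∈ Fintype.piFinset (fun i : Fin 3 =>
      Finset.Ico (2 * (L:ℤ) * u i) (2 * (L:ℤ) * u i + 2 * (L:ℤ))), spinAt x σ)
    (Y₀ := fun σ => ∑ x ∈ Fintype.piFinset (fun _ : Fin 3 => Finset.Ico (0:ℤ) (L:ℤ)), spinAt x σ)
    (Y₁ := fun σ => ∑ x ∈ Fintype.piFinset (fun i : Fin 3 =>
      Finset.Ico ((L:ℤ) * u i) ((L:ℤ) * u i + (L:ℤ))), spinAt x σ)
    (hmeasS _) (hmeasS _) (hmeasS _) (hmeasS _) (hbd _) (hbd _) (hbd _) (hbd _)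
    (dock_integral_blockSum_mul hμc _ _) (dock_integral_blockSum_mul hμc _ _)
    (dock_integral_blockSum_mul hμc _ _) (dock_integral_blockSum_mul hμc _ _) hY₁ hV2 hV1 h1 h0
  have hLr : (0:ℝ) ≤ (L:ℝ) := Nat.cast_nonneg L
  have hsq : Real.sqrt ((L:ℝ) ^ (-θ)) = (L:ℝ) ^ (-(θ / 2)) := by
    rw [Real.sqrt_eq_rpow, ← Real.rpow_mul hLr]
    congr 1
    ring
  calc _ ≤ 2 * Real.sqrt (C * (L:ℝ) ^ (-θ)) := key
    _ = 2 * Real.sqrt C * (L:ℝ) ^ (-(θ / 2)) := by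
        rw [Real.sqrt_mul' _ (Real.rpow_nonneg hLr _), hsq, mul_assoc]

end Summit.CriticalPhenomena.Ising3DConformalLimit.Theorems.CoerciveSharpnessDimensionPinned

end
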